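import Mathlib
import Summits.MatrixMultiplication.MatrixMultiplication.Theorems.SoloBlindFamChecker

/-!
# The type-oracle instance of the branch-and-bound: coordinate types over `𝔽₃`

Solo-blind programme, kernel plan K3.35 step 2 (instance layer).  Slots are `k < 2·3^{m+1}`:
`k / 2 < 3^{m+1}` is the base-`3` code of a COORDINATE TYPE `t ∈ (ZMod 3)^{m+1}` (digits `0..m-1` = the
coordinates of the `m` outside points, digit `m` = the coordinate of the target) and `k % 2` says whether
the slot is a BLOCK type (`0`) or an AMBIENT type (`1`).  Members and constraint sets are bitmasks
`M < 2^m` decoded by `soloBlindDecSet`.  The SPEC functions (`soloBlindOkSpec`, `soloBlindR1Spec`,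
`soloBlindHitSpec`) are stated in `ZMod 3`; the instance `soloBlindInstOf` reads them from memo tables
built with `Array.ofFn`, and `soloBlind_instOf_ok/_r1/_hit` prove the tables agree with the spec.
`soloBlindFamCheck_sound` is the spec-level soundness; `soloBlindCertAll m` checks every proper two-sided
family of member masks over `m` points in both modes (`K`: bound `2^S`; `E`: bound `2^{S-1}`, with the
`H`-constraints switched on).  Nothing here bears on `ω`.
-/

namespace Summit.MatrixMultiplication.MatrixMultiplication.Theorems

open Finset

/-- Digit `a` of the base-`3` code `c`, read in `ZMod 3`. -/
def soloBlindDig (c a : ℕ) : ZMod 3 := ((c / 3 ^ a % 3 : ℕ) : ZMod 3)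

/-- The subset of the `m` points encoded by the bitmask `M`. -/
def soloBlindDecSet (m M : ℕ) : Finset (Fin m) := Finset.univ.filter fun a => M.testBit a

/-- Residue of the type code `c` at the member `M`: `t_τ - ∑_{a ∈ M} t_a`. -/
def soloBlindResid (m c M : ℕ) : ZMod 3 :=
  soloBlindDig c m - ∑ a ∈ soloBlindDecSet m M, soloBlindDig c a

/-- `∑_{a ∈ M} t_a (+ t_τ)` for the type code `c`. -/
def soloBlindTSum (m c M : ℕ) (wt : Bool) : ZMod 3 :=
  (∑ a ∈ soloBlindDecSet m M, soloBlindDig c a) + if wt then soloBlindDig c m else 0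

/-- Usability of slot `k` at member `M`: ambient slots need residue `0`, block slots residue `≠ 2`. -/
def soloBlindOkSpec (m k M : ℕ) : Bool :=
  if k % 2 = 1 then decide (soloBlindResid m (k / 2) M = 0) else decide (soloBlindResid m (k / 2) M ≠ 2)

/-- Slot `k` counts at member `M`: a block slot with residue `1`. -/
def soloBlindR1Spec (m k M : ℕ) : Bool :=
  decide (k % 2 = 0) && decide (soloBlindResid m (k / 2) M = 1)

/-- Slot `k` hits constraint `c`: constraints `c < 2^m - 1` are `zsf(T)` with `T = c + 1`, constraints
`c ≥ 2^m - 1` are `H(T)` with `T = c + 1 - 2^m`; a block slot hits iff the relevant sum is `1`, an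
ambient slot iff it is nonzero. -/
def soloBlindHitSpec (m k c : ℕ) : Bool :=
  let s := if c + 1 < 2 ^ m then soloBlindTSum m (k / 2) (c + 1) false
    else soloBlindTSum m (k / 2) (c + 1 - 2 ^ m) true
  if k % 2 = 1 then decide (s ≠ 0) else decide (s = 1)

/-- Total `Bool` array access. -/
def soloBlindAGet (A : Array Bool) (i : ℕ) : Bool := if h : i < A.size then A[i] else false

/-- Memo tables of the spec functions for `m` points. -/
structure SoloBlindTabs where
  /-- `okT[k * 2^m + M]` -/
  okT : Array Bool
  /-- `r1T[k * 2^m + M]` -/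
  r1T : Array Bool
  /-- `hitT[k * (2^(m+1) - 1) + c]` -/
  hitT : Array Bool

/-- Build the memo tables. -/
def soloBlindMkTabs (m : ℕ) : SoloBlindTabs where
  okT := Array.ofFn (n := 2 * 3 ^ (m + 1) * 2 ^ m) fun i => soloBlindOkSpec m (i / 2 ^ m) (i % 2 ^ m)
  r1T := Array.ofFn (n := 2 * 3 ^ (m + 1) * 2 ^ m) fun i => soloBlindR1Spec m (i / 2 ^ m) (i % 2 ^ m)
  hitT := Array.ofFn (n := 2 * 3 ^ (m + 1) * (2 ^ (m + 1) - 1)) fun i =>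
    soloBlindHitSpec m (i / (2 ^ (m + 1) - 1)) (i % (2 ^ (m + 1) - 1))

/-- Number of constraints: `2^m - 1` zero-sum-freeness constraints, plus `2^m` `H`-constraints in mode `E`. -/
def soloBlindNCons (m : ℕ) (modeE : Bool) : ℕ := if modeE then 2 ^ (m + 1) - 1 else 2 ^ m - 1

/-- The branch-and-bound instance of the family `F` (member masks) over `m` points. -/
def soloBlindInstOf (T : SoloBlindTabs) (m : ℕ) (F : List ℕ) (modeE : Bool) : SoloBlindBBInst where
  nW := 2 * 3 ^ (m + 1)
  ncons := soloBlindNCons m modeE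
  members := F
  csz M := (soloBlindDecSet m M).card
  ok k := F.all fun M => soloBlindAGet T.okT (k * 2 ^ m + M)
  r1 k M := soloBlindAGet T.r1T (k * 2 ^ m + M)
  hit k c := soloBlindAGet T.hitT (k * (2 ^ (m + 1) - 1) + c)

/-- The family check in mode `K` (bound `2^S`) or `E` (bound `2^{S-1}`). -/
def soloBlindFamCheck (T : SoloBlindTabs) (m S : ℕ) (F : List ℕ) (modeE : Bool) : Bool :=
  soloBlindCheck (soloBlindInstOf T m F modeE) S (if modeE then 2 ^ (S - 1) else 2 ^ S)

/-- The family is proper: some mask `M < 2^m` is not a member. -/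
def soloBlindProperB (m : ℕ) (F : List ℕ) : Bool := !(List.range (2 ^ m)).all fun M => F.elem M

/-- The family is two-sided: every point lies inside some member and outside some member. -/
def soloBlindTwoSidedB (m : ℕ) (F : List ℕ) : Bool :=
  (List.range m).all fun a => F.any (fun M => M.testBit a) && F.any (fun M => !M.testBit a)

/-- The scaling exponent of the certificates. -/
def soloBlindScale : ℕ := 40

/-- CERTIFICATE GENERATOR: every proper two-sided family of masks over `m` points passes both checks. -/
def soloBlindCertAll (m : ℕ) : Bool :=
  let T := soloBlindMkTabs m
  (List.range (2 ^ m)).sublists.all fun F =>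
    !(soloBlindProperB m F && soloBlindTwoSidedB m F) ||
      (soloBlindFamCheck T m soloBlindScale F false && soloBlindFamCheck T m soloBlindScale F true)

/-! ## The tables agree with the spec -/

/-- Table access of an `Array.ofFn` inside its range. -/
theorem soloBlindAGet_ofFn {n : ℕ} (f : Fin n → Bool) {i : ℕ} (hi : i < n) :
    soloBlindAGet (Array.ofFn f) i = f ⟨i, hi⟩ := by
  unfold soloBlindAGet
  rw [dif_pos (by rw [Array.size_ofFn]; exact hi), Array.getElem_ofFn]

/-- Row-major index bound. -/
private theorem soloBlind_index_lt {a b k M : ℕ} (hk : k < a) (hM : M < b) : k * b + M < a * b := by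
  calc k * b + M < k * b + b := by omega
    _ = (k + 1) * b := by ring
    _ ≤ a * b := Nat.mul_le_mul_right b hk

/-- Row-major index: quotient. -/
private theorem soloBlind_rowMajor_div {b k M : ℕ} (hM : M < b) : (k * b + M) / b = k := by
  rw [Nat.mul_comm, Nat.mul_add_div (by omega), Nat.div_eq_of_lt hM, Nat.add_zero]

/-- The memoised usability agrees with the spec. -/
theorem soloBlind_instOf_ok {m : ℕ} {F : List ℕ} (hF : ∀ M ∈ F, M < 2 ^ m) (modeE : Bool) {k : ℕ}
    (hk : k < 2 * 3 ^ (m + 1)) :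
    (soloBlindInstOf (soloBlindMkTabs m) m F modeE).ok k = true ↔
      ∀ M ∈ F, soloBlindOkSpec m k M = true := by
  show (F.all fun M => soloBlindAGet (soloBlindMkTabs m).okT (k * 2 ^ m + M)) = true ↔ _
  rw [List.all_eq_true]
  refine forall₂_congr fun M hM => ?_
  have hM2 := hF M hM
  rw [soloBlindMkTabs, soloBlindAGet_ofFn _ (soloBlind_index_lt hk hM2)]
  simp only
  rw [soloBlind_rowMajor_div hM2, Nat.mul_add_mod_of_lt hM2]

/-- The memoised residue-one incidence agrees with the spec. -/
theorem soloBlind_instOf_r1 {m : ℕ} (F : List ℕ) (modeE : Bool) {k M : ℕ}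
    (hk : k < 2 * 3 ^ (m + 1)) (hM : M < 2 ^ m) :
    (soloBlindInstOf (soloBlindMkTabs m) m F modeE).r1 k M = soloBlindR1Spec m k M := by
  show soloBlindAGet (soloBlindMkTabs m).r1T (k * 2 ^ m + M) = _
  rw [soloBlindMkTabs, soloBlindAGet_ofFn _ (soloBlind_index_lt hk hM)]
  simp only
  rw [soloBlind_rowMajor_div hM, Nat.mul_add_mod_of_lt hM]

/-- The number of constraints is at most `2^{m+1} - 1`. -/
theorem soloBlind_ncons_le (m : ℕ) (modeE : Bool) : soloBlindNCons m modeE ≤ 2 ^ (m + 1) - 1 := by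
  unfold soloBlindNCons
  split_ifs
  · exact le_rfl
  · have : 2 ^ m ≤ 2 ^ (m + 1) := Nat.pow_le_pow_right (by norm_num) (by omega)
    omega

/-- The memoised hitting relation agrees with the spec. -/
theorem soloBlind_instOf_hit {m : ℕ} (F : List ℕ) (modeE : Bool) {k c : ℕ}
    (hk : k < 2 * 3 ^ (m + 1)) (hc : c < 2 ^ (m + 1) - 1) :
    (soloBlindInstOf (soloBlindMkTabs m) m F modeE).hit k c = soloBlindHitSpec m k c := by
  show soloBlindAGet (soloBlindMkTabs m).hitT (k * (2 ^ (m + 1) - 1) + c) = _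
  rw [soloBlindMkTabs, soloBlindAGet_ofFn _ (soloBlind_index_lt hk hc)]
  simp only
  rw [soloBlind_rowMajor_div hc, Nat.mul_add_mod_of_lt hc]

/-- SPEC-LEVEL SOUNDNESS of the family check: for a family `F` of masks `< 2^m` passing the check, every
set `V` of slots `< 2·3^{m+1}` that is usable at every member and hits every constraint has
`∑_{M ∈ F} max(2^{S - |M| - #{k ∈ V : r1Spec k M}}, 1) ≤ bound`, i.e. the truncated powers
`soloBlindPow2T S (|M| + #{…})` (exponents above `S` are rounded up to the value `1`), with bound `2^S`
in mode `K` and `2^{S-1}` in mode `E`. -/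
theorem soloBlindFamCheck_sound {m S : ℕ} {F : List ℕ} (hF : ∀ M ∈ F, M < 2 ^ m) {modeE : Bool}
    (h : soloBlindFamCheck (soloBlindMkTabs m) m S F modeE = true) (V : Finset ℕ)
    (hV : ∀ k ∈ V, k < 2 * 3 ^ (m + 1)) (hok : ∀ k ∈ V, ∀ M ∈ F, soloBlindOkSpec m k M = true)
    (hhit : ∀ c < soloBlindNCons m modeE, ∃ k ∈ V, soloBlindHitSpec m k c = true) :
    (F.map fun M => soloBlindPow2T S ((soloBlindDecSet m M).card +
      (V.filter fun k => soloBlindR1Spec m k M = true).card)).sum ≤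
      (if modeE then 2 ^ (S - 1) else 2 ^ S) := by
  have hs := soloBlindCheck_sound _ S _ h V
    (fun k hk => ⟨hV k hk, (soloBlind_instOf_ok hF modeE (hV k hk)).mpr fun M hM => hok k hk M hM⟩)
    (fun c hc => by
      obtain ⟨k, hkV, hkc⟩ := hhit c hc
      exact ⟨k, hkV, by
        rw [soloBlind_instOf_hit F modeE (hV k hkV) (lt_of_lt_of_le hc (soloBlind_ncons_le m modeE))]
        exact hkc⟩)
  have hval : soloBlindVal (soloBlindInstOf (soloBlindMkTabs m) m F modeE) S V =
      (F.map fun M => soloBlindPow2T S ((soloBlindDecSet m M).card +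
        (V.filter fun k => soloBlindR1Spec m k M = true).card)).sum := by
    unfold soloBlindVal soloBlindCnt
    show (F.map fun M => soloBlindPow2T S ((soloBlindDecSet m M).card + _)).sum = _
    congr 1
    apply List.map_congr_left
    intro M hM
    congr 2
    apply congrArg Finset.card
    apply Finset.filter_congr
    intro k hk
    rw [soloBlind_instOf_r1 F modeE (hV k hk) (hF M hM)]
  rw [hval] at hs
  exact hs

/-- EXTRACTION from the certificate generator: a proper two-sided family of masks (given as a sublist of
`range (2^m)`) passes both checks. -/
theorem soloBlind_certAll_extract {m : ℕ} (h : soloBlindCertAll m = true) {F : List ℕ}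
    (hsub : F.Sublist (List.range (2 ^ m))) (hprop : ∃ M < 2 ^ m, M ∉ F)
    (hts : ∀ a < m, (∃ M ∈ F, M.testBit a = true) ∧ (∃ M ∈ F, M.testBit a = false)) :
    soloBlindFamCheck (soloBlindMkTabs m) m soloBlindScale F false = true ∧
      soloBlindFamCheck (soloBlindMkTabs m) m soloBlindScale F true = true := by
  unfold soloBlindCertAll at h
  rw [List.all_eq_true] at h
  have hF := h F (List.mem_sublists.mpr hsub)
  have hp : soloBlindProperB m F = true := by
    unfold soloBlindProperB
    obtain ⟨M, hM, hMF⟩ := hprop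
    rw [Bool.not_eq_true', Bool.eq_false_iff, Ne, List.all_eq_true]
    intro hall
    have := hall M (List.mem_range.mpr hM)
    exact hMF (List.mem_of_elem_eq_true this)
  have ht : soloBlindTwoSidedB m F = true := by
    unfold soloBlindTwoSidedB
    rw [List.all_eq_true]
    intro a ha
    rw [List.mem_range] at ha
    obtain ⟨⟨M, hM, hMa⟩, ⟨M', hM', hM'a⟩⟩ := hts a ha
    rw [Bool.and_eq_true, List.any_eq_true, List.any_eq_true]
    exact ⟨⟨M, hM, hMa⟩, ⟨M', hM', by simp [hM'a]⟩⟩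
  rw [hp, ht] at hF
  simpa using hF

/-! ## Sanity checks (the constraints are not vacuous) and certificates -/

/-- Sanity: without the `H`-constraints the `E`-bound fails already for the family `{∅, {p}, {q}}`
over two points (mode `K` run against the bound `2^{S-1}`). -/
example : soloBlindCheck (soloBlindInstOf (soloBlindMkTabs 2) 2 [0, 1, 2] false) soloBlindScale
    (2 ^ (soloBlindScale - 1)) = false := by native_decide

/-- Sanity: the all-present family over two points reaches mass `1` (the bound `2^S - 1` fails) but
respects `1` and, with the `H`-constraints, `1/2`. -/
example : soloBlindCheck (soloBlindInstOf (soloBlindMkTabs 2) 2 [0, 1, 2, 3] false) soloBlindScale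
    (2 ^ soloBlindScale - 1) = false ∧
    soloBlindFamCheck (soloBlindMkTabs 2) 2 soloBlindScale [0, 1, 2, 3] false = true ∧
    soloBlindFamCheck (soloBlindMkTabs 2) 2 soloBlindScale [0, 1, 2, 3] true = true := by native_decide

/-- The numbers of proper two-sided (labelled) families of masks over `2` and `3` points: `6` and `192`
(`5` and `59` up to the symmetric group, K3.32). -/
example : (((List.range (2 ^ 2)).sublists.filter fun F => soloBlindProperB 2 F && soloBlindTwoSidedB 2 F).length,
    ((List.range (2 ^ 3)).sublists.filter fun F => soloBlindProperB 3 F && soloBlindTwoSidedB 3 F).length) =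
    (6, 192) := by native_decide


/-- Corank `0`, `1`, `2`: every proper two-sided family passes. -/
theorem soloBlind_certAll_zero : soloBlindCertAll 0 = true := by native_decide

/-- Corank `1`: no proper two-sided family exists; the generator passes vacuously. -/
theorem soloBlind_certAll_one : soloBlindCertAll 1 = true := by native_decide

/-- Corank `2`: the five proper two-sided families (up to symmetry) pass. -/
theorem soloBlind_certAll_two : soloBlindCertAll 2 = true := by native_decide

/-- Corank `3`: every proper two-sided family over three points passes (`192` labelled families). -/
theorem soloBlind_certAll_three : soloBlindCertAll 3 = true := by native_decide

end Summit.MatrixMultiplication.MatrixMultiplication.Theorems
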